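import Summits.NavierStokesRegularity.FluidComputer.PalasekTowerGermHostFarPusher
import Summits.NavierStokesRegularity.FluidComputer.PalasekTowerGermHostDesign

/-!
# The germ host, XIII: THE FIRST KERNEL INHABITANT OF THE STRICT SLOT `Germ.LevelZeroData`

Cell `ns-blowup`, seat `ns-blowup-ecbridge-3` (g3); GROUP C «BRIDGE SUPPORT» of the route
`PalasekTowerBreakdown` (crux `EpisodeBaseG`, item stmt-NavierStokesRegularity-19179, R2 of record).
Sequel of `PalasekTowerGermHostFarPusher.lean` (the explicit potential `ψ`, the far pusher `W`).
LABEL: E–C typing (KERNEL construction: the profile, one scale constant, one schedule — definitions with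
body — and their calculus; everything proved). WHAT THIS IS NOT: not Navier–Stokes evidence. The profile
below passes the register's LEVEL-`0` READOUTS and the STRICT FIRST-ORDER ANCHOR TEST at ONE instant; its
carrier is ecbridge-4's tiny, viscously FLAT blob (radius `2a ≤ 10/256`, `L³`-small), pushed forward by
the pressure of an `O(1)` slow horizontal swirl far ahead of it. Nothing here says the speed maximum keeps
rising after `τ₀` (the blob dissipates at rate `∼ ν/a²`), nothing about `FirstEpisodeD`, `EpisodeBaseG`,
`RungG 1` or blow-up. What it DOES settle: the typed slot of the germ host (`LevelZeroData`, p443639) is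
inhabited by a closed kernel term, so `S⋆ :=` the germ schedule of this profile is a NAMED prepared host
in its singleton class (`HostPreparationD (HostClass.exact S⋆)`, §3) — the `∃`-free question left for
this `S⋆` is `FirstEpisodeD (HostClass.exact S⋆)` alone.

## The design (unit viscosity in the slot; the anchor test is proved at every `ν`)

* carrier `U₁ = TinyBlob.tinyProfile a = Y₀ • B_a` (p452553, ecbridge-4): smooth, divergence free,
  supported in `B̄(0, 2a)`, even, flat at the centre (`DU₁(0) = 0`, `ΔU₁(0) = 0`), `‖U₁‖ ≤ Y₀` with
  equality exactly at `0`, `U₁(0) = Y₀ e₃`; strain floor `A₀` and the `N₀`-core loop for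
  `a ≤ strainConst/256`, `a ≤ 5/256`;
* pusher `W = farPusher = horizField (Y₀ e₃) ψ` (XII): `‖W‖ ≤ (15/32)Y₀`, `tsupport W ⊆ B̄(5e₃, 5/4)`, in
  the far forward cone of `e₃` seen from `0`, non-degenerate at `x₁ = 5e₃ + e₁/2`;
* profile `U = U₁ + W` (`strictTinyProfile a`), radius `ρ = 7`.

§1 the profile and its readouts (ceiling, argmax `= {0}`, **`anchor_strictTinyProfile`** at every `ν` via
`inner_accel_pos_of_flat_horizontal`, support, divergence, strain, core loop); §2
**`levelZeroData_strictTinyProfile`** (`LevelZeroData (strictTinyProfile a) 7` for `0 < a ≤ 5/256`,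
`a ≤ strainConst/256`), `strictTinyScale`, `levelZeroData_named`, `exists_levelZeroData`; §3 the named host
`strictTinySchedule c₄ = S⋆`: `HostPreparationD (HostClass.exact S⋆)`, prepared also in
`exact S⋆ ⊓ rising κ` for some `κ > 0` and in the `GoodHost` shape, and
`EpisodeBaseG ⇐ FirstEpisodeD (HostClass.exact S⋆)`.

References: S. Palasek, arXiv:2605.13827 §3.3 (host preparation before the first readout), §4
[cite: Palasek2026ElementaryModel, §3.3]; A. J. Majda, A. L. Bertozzi, *Vorticity and Incompressible
Flow* (CUP 2002), §1.8 Prop. 1.16 [cite: MajdaBertozziCUP2002, §1.8 Prop. 1.16].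
-/

noncomputable section

namespace Summit.NavierStokesRegularity.FluidComputer.PalasekTowerClayBridge.Germ

open Set Function Filter Topology InnerProductSpace Metric MeasureTheory Real
open scoped Topology ContDiff RealInnerProductSpace Laplacian

open Literature.Analysis.FluidPDE TinyBlob

/-! ## §1 The profile `U = U₁ + W` and its readouts -/

/-- **THE STRICT TINY PROFILE** `U = tinyProfile a + farPusher`. [folklore] -/
def strictTinyProfile (a : ℝ) : EuclideanSpace ℝ (Fin 3) → EuclideanSpace ℝ (Fin 3) :=
  tinyProfile a + farPusher

section Profile

variable {a : ℝ}

/-- Pointwise form. [folklore] -/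
theorem strictTinyProfile_apply (a : ℝ) (x : EuclideanSpace ℝ (Fin 3)) :
    strictTinyProfile a x = tinyProfile a x + farPusher x := rfl

/-- `U = U₁ + horizField (U₁ 0) ψ` (the shape of `inner_accel_pos_of_flat_horizontal`). [folklore] -/
theorem strictTinyProfile_eq (a : ℝ) :
    strictTinyProfile a = tinyProfile a + horizField (tinyProfile a 0) pusherPot := by
  rw [strictTinyProfile, farPusher_eq a]

/-- `U` is smooth. [folklore] -/
theorem contDiff_strictTinyProfile (a : ℝ) : ContDiff ℝ ∞ (strictTinyProfile a) :=
  (contDiff_tinyProfile a).add contDiff_farPusher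

/-- The carrier vanishes off `B̄(0, 1)` once `a ≤ 5/256`. [folklore] -/
theorem tinyProfile_eq_zero_of_one_lt (ha : 0 < a) (h5 : a ≤ 5 / 256) {x : EuclideanSpace ℝ (Fin 3)}
    (hx : 1 < ‖x‖) : tinyProfile a x = 0 :=
  tinyProfile_eq_zero_of_norm_gt ha (by linarith)

/-- Near the origin (`‖x‖ < 15/4`) the profile is the carrier. [folklore] -/
theorem strictTinyProfile_of_norm_lt {x : EuclideanSpace ℝ (Fin 3)} (hx : ‖x‖ < 15 / 4) :
    strictTinyProfile a x = tinyProfile a x := by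
  rw [strictTinyProfile_apply, farPusher_eq_zero_of_norm_lt hx, add_zero]

/-- Far from the origin (`‖x‖ > 1`) the profile is the pusher. [folklore] -/
theorem strictTinyProfile_of_one_lt (ha : 0 < a) (h5 : a ≤ 5 / 256) {x : EuclideanSpace ℝ (Fin 3)}
    (hx : 1 < ‖x‖) : strictTinyProfile a x = farPusher x := by
  rw [strictTinyProfile_apply, tinyProfile_eq_zero_of_one_lt ha h5 hx, zero_add]

/-- `U(0) = U₁(0) = Y₀ e₃`. [folklore] -/
theorem strictTinyProfile_zero (a : ℝ) : strictTinyProfile a 0 = tinyProfile a 0 :=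
  strictTinyProfile_of_norm_lt (by simp)

/-- `‖U(0)‖ = Y₀`. [folklore] -/
theorem norm_strictTinyProfile_zero (a : ℝ) : ‖strictTinyProfile a 0‖ = TowerRates.wide.Y 0 := by
  rw [strictTinyProfile_zero, norm_tinyProfile_zero]

/-- The supports of carrier and potential are disjoint. [folklore] -/
theorem disjoint_tsupport (ha : 0 < a) (h5 : a ≤ 5 / 256) :
    Disjoint (tsupport (tinyProfile a)) (tsupport pusherPot) := by
  refine Set.disjoint_left.2 fun x hx hx' => ?_
  have h1 : ‖x‖ ≤ 2 * a := by
    have := tsupport_tinyProfile_subset ha hx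
    rwa [mem_closedBall, dist_zero_right] at this
  have h2 := (geometry_of_mem_tsupport hx').2.2
  linarith

/-- **Speed ceiling** `‖U‖ ≤ Y₀`. [folklore] -/
theorem norm_strictTinyProfile_le (ha : 0 < a) (h5 : a ≤ 5 / 256) (x : EuclideanSpace ℝ (Fin 3)) :
    ‖strictTinyProfile a x‖ ≤ TowerRates.wide.Y 0 := by
  by_cases hx : ‖x‖ < 15 / 4
  · rw [strictTinyProfile_of_norm_lt hx]; exact norm_tinyProfile_le ha.ne' x
  · push Not at hx
    rw [strictTinyProfile_of_one_lt ha h5 (by linarith)]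
    exact (norm_farPusher_lt x).le

/-- **The argmax is the origin**: `‖U x‖ = Y₀ → x = 0`. [folklore] -/
theorem eq_zero_of_norm_strictTinyProfile_eq (ha : 0 < a) (h5 : a ≤ 5 / 256) {x : EuclideanSpace ℝ (Fin 3)}
    (hx : ‖strictTinyProfile a x‖ = TowerRates.wide.Y 0) : x = 0 := by
  by_cases hn : ‖x‖ < 15 / 4
  · rw [strictTinyProfile_of_norm_lt hn] at hx; exact eq_zero_of_norm_tinyProfile_eq ha.ne' hx
  · push Not at hn
    rw [strictTinyProfile_of_one_lt ha h5 (by linarith)] at hx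
    exact absurd hx (norm_farPusher_lt x).ne

/-- `U₁` is even about `0`. [folklore] -/
theorem isEvenAbout_tinyProfile (a : ℝ) : IsEvenAbout 0 (tinyProfile a) := fun x => by
  show tinyProfile a (0 + (0 - x)) = tinyProfile a x
  rw [zero_add, zero_sub, tinyProfile_neg]

/-- **THE STRICT ANCHOR TEST AT EVERY VISCOSITY**: `‖U x‖ = Y₀ → 0 < ⟪U x, accel ν U x⟫`. [cite: MajdaBertozziCUP2002, §1.8 Prop. 1.16] -/
theorem anchor_strictTinyProfile (ha : 0 < a) (h5 : a ≤ 5 / 256) (ν : ℝ) (x : EuclideanSpace ℝ (Fin 3))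
    (hx : ‖strictTinyProfile a x‖ = TowerRates.wide.Y 0) :
    0 < ⟪strictTinyProfile a x, accel ν (strictTinyProfile a) x⟫ := by
  obtain rfl := eq_zero_of_norm_strictTinyProfile_eq ha h5 hx
  rw [strictTinyProfile_eq a]
  have hfar : ∀ y ∈ tsupport pusherPot, (1 : ℝ) < ‖(0 : EuclideanSpace ℝ (Fin 3)) - y‖ := fun y hy => by
    rw [zero_sub, norm_neg]; linarith [(geometry_of_mem_tsupport hy).2.2]
  have hfwd : ∀ y ∈ tsupport pusherPot, ⟪(0 : EuclideanSpace ℝ (Fin 3)) - y, tinyProfile a 0⟫ ≤ 0 :=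
    fun y hy => by rw [tinyProfile_zero]; exact forward_farPusher hy
  have hcone : ∀ y ∈ tsupport pusherPot,
      5 * ⟪(0 : EuclideanSpace ℝ (Fin 3)) - y, horizField (tinyProfile a 0) pusherPot y⟫ ^ 2 ≤
        ‖(0 : EuclideanSpace ℝ (Fin 3)) - y‖ ^ 2 * ‖horizField (tinyProfile a 0) pusherPot y‖ ^ 2 :=
    fun y hy => by rw [← farPusher_eq]; exact cone_farPusher hy
  have hfwd₁ : ⟪(0 : EuclideanSpace ℝ (Fin 3)) - strictPt, tinyProfile a 0⟫ < 0 := by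
    rw [tinyProfile_zero]; exact forward_strictPt
  have hcone₁ : 5 * ⟪(0 : EuclideanSpace ℝ (Fin 3)) - strictPt, horizField (tinyProfile a 0) pusherPot strictPt⟫ ^ 2 <
      ‖(0 : EuclideanSpace ℝ (Fin 3)) - strictPt‖ ^ 2 * ‖horizField (tinyProfile a 0) pusherPot strictPt‖ ^ 2 := by
    rw [← farPusher_eq]; exact cone_strictPt
  exact inner_accel_pos_of_flat_horizontal (contDiff_tinyProfile a) (hasCompactSupport_tinyProfile ha)
    (isDivFree_tinyProfile ha.ne') (isEvenAbout_tinyProfile a) (laplacian_tinyProfile_zero a)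
    contDiff_pusherPot hasCompactSupport_pusherPot (disjoint_tsupport ha h5) one_pos hfar hfwd hcone
    hfwd₁ hcone₁

/-- `tsupport U ⊆ B̄(0, 7)`. [folklore] -/
theorem tsupport_strictTinyProfile_subset (ha : 0 < a) (h5 : a ≤ 5 / 256) :
    tsupport (strictTinyProfile a) ⊆ closedBall (0 : EuclideanSpace ℝ (Fin 3)) 7 := by
  refine closure_minimal (fun x hx => ?_) isClosed_closedBall
  rw [mem_closedBall, dist_zero_right]
  by_contra hfar
  push Not at hfar
  refine hx ?_
  rw [strictTinyProfile_of_one_lt ha h5 (by linarith)]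
  refine farPusher_eq_zero fun hmem => ?_
  have h1 := (geometry_of_mem_tsupport hmem).1
  have : ‖x‖ ≤ ‖x - pusherCenter‖ + ‖pusherCenter‖ := norm_le_norm_sub_add x pusherCenter
  rw [norm_pusherCenter] at this
  linarith

/-- `U` has compact support. [folklore] -/
theorem hasCompactSupport_strictTinyProfile (ha : 0 < a) (h5 : a ≤ 5 / 256) :
    HasCompactSupport (strictTinyProfile a) :=
  (isCompact_closedBall (0 : EuclideanSpace ℝ (Fin 3)) 7).of_isClosed_subset (isClosed_tsupport _)
    (tsupport_strictTinyProfile_subset ha h5)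

/-- `U` is divergence free. [folklore] -/
theorem isDivFree_strictTinyProfile (ha : a ≠ 0) : VectorCalculus.IsDivFree (strictTinyProfile a) := by
  intro x
  have h1 := isDivFree_tinyProfile ha x
  have h2 := isDivFree_farPusher x
  simp only [VectorCalculus.divergence] at h1 h2 ⊢
  rw [strictTinyProfile, fderiv_add ((contDiff_tinyProfile a).differentiable (by simp) x)
    (contDiff_farPusher.differentiable (by simp) x)]
  push_cast
  rw [map_add, h1, h2, add_zero]

/-- Near the origin the Jacobian of `U` is the carrier's. [folklore] -/
theorem fderiv_strictTinyProfile_of_norm_lt {x : EuclideanSpace ℝ (Fin 3)} (hx : ‖x‖ < 15 / 4) :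
    fderiv ℝ (strictTinyProfile a) x = fderiv ℝ (tinyProfile a) x := by
  have hev : strictTinyProfile a =ᶠ[𝓝 x] tinyProfile a := by
    have hopen : IsOpen {y : EuclideanSpace ℝ (Fin 3) | ‖y‖ < 15 / 4} := isOpen_lt continuous_norm continuous_const
    filter_upwards [hopen.mem_nhds hx] with y hy
    exact strictTinyProfile_of_norm_lt hy
  exact hev.fderiv_eq

/-- **The strain floor** is the carrier's. [folklore] -/
theorem strain_strictTinyProfile (ha : 0 < a) (h5 : a ≤ 5 / 256) (hκ : a ≤ strainConst / 256) :
    ∃ x : EuclideanSpace ℝ (Fin 3), ‖x‖ ≤ 7 ∧ TowerRates.wide.A 0 ≤ ‖fderiv ℝ (strictTinyProfile a) x‖ := by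
  have hn : ‖a • strainPt‖ ≤ 2 * a := by
    rw [norm_smul, Real.norm_eq_abs, abs_of_pos ha]; nlinarith [norm_strainPt_le]
  refine ⟨a • strainPt, by linarith, ?_⟩
  rw [fderiv_strictTinyProfile_of_norm_lt (by linarith)]
  exact strain_tinyProfile ha hκ

/-- **The core loop** is the carrier's (the pusher vanishes along it). [folklore] -/
theorem core_strictTinyProfile (ha : 0 < a) (h5 : a ≤ 5 / 256) :
    ∃ (x : EuclideanSpace ℝ (Fin 3)) (γ : ℝ → EuclideanSpace ℝ (Fin 3)),
      ‖x‖ ≤ 7 ∧ ContDiff ℝ 1 γ ∧ γ 0 = γ 1 ∧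
        (∀ s ∈ Icc (0 : ℝ) 1, γ s ∈ closedBall x (1 / TowerRates.wide.N 0)) ∧
        (∀ s ∈ Icc (0 : ℝ) 1, ‖deriv γ s‖ ≤ 8 * Real.pi / TowerRates.wide.N 0) ∧
        TowerRates.wide.N 0 ^ (TowerRates.wide.β - 2) ≤ circulation (strictTinyProfile a) γ := by
  obtain ⟨x, γ, hx, hγ, h01, hball, hvel, hcirc⟩ := core_tinyProfile ha h5
  refine ⟨x, γ, by linarith, hγ, h01, hball, hvel, ?_⟩
  have hc : circulation (strictTinyProfile a) γ = circulation (tinyProfile a) γ := by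
    unfold circulation
    refine intervalIntegral.integral_congr fun s hs => ?_
    rw [uIcc_of_le zero_le_one] at hs
    have hs' : ‖γ s‖ < 15 / 4 := by
      have hb := hball s hs
      rw [mem_closedBall, dist_eq_norm, Host.wide_N_zero] at hb
      have : ‖γ s‖ ≤ ‖γ s - x‖ + ‖x‖ := norm_le_norm_sub_add (γ s) x
      linarith
    simp only [strictTinyProfile_of_norm_lt hs']
  rw [hc]
  exact hcirc

/-! ## §2 The strict slot is inhabited -/

/-- **THE FIRST KERNEL INHABITANT OF THE STRICT SLOT**: `LevelZeroData (strictTinyProfile a) 7` for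
`0 < a ≤ 5/256`, `a ≤ strainConst/256`. [cite: Palasek2026ElementaryModel, §3.3] -/
theorem levelZeroData_strictTinyProfile (ha : 0 < a) (h5 : a ≤ 5 / 256) (hκ : a ≤ strainConst / 256) :
    LevelZeroData (strictTinyProfile a) 7 where
  smooth := contDiff_strictTinyProfile a
  support := tsupport_strictTinyProfile_subset ha h5
  divFree := isDivFree_strictTinyProfile ha.ne'
  ceiling := norm_strictTinyProfile_le ha h5
  floor := ⟨0, by simp, (norm_strictTinyProfile_zero a).ge⟩
  strain := strain_strictTinyProfile ha h5 hκ
  core := core_strictTinyProfile ha h5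
  anchor := anchor_strictTinyProfile ha h5 1

end Profile

/-- **The admissible scale** `a⋆ = min (5/256) (strainConst/256)`. [folklore] -/
def strictTinyScale : ℝ := min (5 / 256) (strainConst / 256)

/-- `0 < a⋆`. [folklore] -/
theorem strictTinyScale_pos : 0 < strictTinyScale :=
  lt_min (by norm_num) (div_pos strainConst_pos (by norm_num))

/-- **THE NAMED PROFILE** `U⋆ = strictTinyProfile a⋆` fills the strict slot. [cite: Palasek2026ElementaryModel, §3.3] -/
theorem levelZeroData_named : LevelZeroData (strictTinyProfile strictTinyScale) 7 :=
  levelZeroData_strictTinyProfile strictTinyScale_pos (min_le_left _ _) (min_le_right _ _)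

/-- **The strict slot is inhabited.** [cite: Palasek2026ElementaryModel, §3.3] -/
theorem exists_levelZeroData :
    ∃ U : EuclideanSpace ℝ (Fin 3) → EuclideanSpace ℝ (Fin 3), LevelZeroData U 7 :=
  ⟨_, levelZeroData_named⟩

/-! ## §3 The named prepared host `S⋆` -/

/-- **`S⋆`: THE GERM SCHEDULE OF THE NAMED PROFILE** (box schedule, zero datum, radius `7`, force = the
faded NS residual of the matched germ of `U⋆`, push constant `c₄`). [cite: Palasek2026ElementaryModel, §3.3] -/
def strictTinySchedule (c₄ : ℝ) (hc₄ : 0 < c₄) (hc₄' : c₄ ≤ 1) : Schedule TowerRates.wide :=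
  levelZeroData_named.schedule c₄ hc₄ hc₄'

/-- **HOST PREPARATION FOR THE NAMED `S⋆`**: `HostPreparationD (HostClass.exact S⋆)` — pinned
(`Λ = 8`, `θ = 6/5`), rigid, quiet, with its globally anchored registered level-`0` stage whose velocity at
`τ₀ = 1` is `U⋆` and whose force vanishes at `τ₀`. [cite: Palasek2026ElementaryModel, §3.3] -/
theorem hostPreparationD_strictTinySchedule {c₄ : ℝ} (hc₄ : 0 < c₄) (hc₄' : c₄ ≤ 1) :
    HostPreparationD (HostClass.exact (strictTinySchedule c₄ hc₄ hc₄')) :=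
  levelZeroData_named.hostPreparationD_exact hc₄ hc₄'

/-- **Positive rising rate** (contrast: the Host series of record is prepared in NO `rising κ`, `κ > 0` —
`Host.not_hostPreparationD_exact_inter_rising`): `S⋆` is prepared in `exact S⋆ ⊓ rising κ` for some
`κ > 0` (the minimum of the anchor test values on the argmax `{0}`). [folklore] -/
theorem exists_hostPreparationD_strictTinySchedule_rising {c₄ : ℝ} (hc₄ : 0 < c₄) (hc₄' : c₄ ≤ 1) :
    ∃ κ : ℝ, 0 < κ ∧
      HostPreparationD ((HostClass.exact (strictTinySchedule c₄ hc₄ hc₄')).inter (HostClass.rising κ)) :=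
  levelZeroData_named.exists_hostPreparationD_exact_inter_rising hc₄ hc₄'

/-- **The `GoodHost` shape of record, filled by a kernel term**: `exact S⋆ ⊓ (nearC1 {U⋆} 0 0 ⊓ rising rate)`
is prepared, `rate > 0`. [cite: Palasek2026ElementaryModel, §3.3] -/
theorem hostPreparationD_strictTinySchedule_goodHost {c₄ : ℝ} (hc₄ : 0 < c₄) (hc₄' : c₄ ≤ 1) :
    HostPreparationD ((HostClass.exact (strictTinySchedule c₄ hc₄ hc₄')).inter
      ((HostClass.nearC1 {strictTinyProfile strictTinyScale} 0 0).inter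
        (HostClass.rising levelZeroData_named.rate))) :=
  levelZeroData_named.hostPreparationD_goodHost hc₄ hc₄'

/-- **The crux for `S⋆` is its episode alone**: `FirstEpisodeD (HostClass.exact S⋆) → EpisodeBaseG`.
[cite: Palasek2026ElementaryModel, §4] -/
theorem episodeBaseG_of_firstEpisodeD_strictTinySchedule {c₄ : ℝ} (hc₄ : 0 < c₄) (hc₄' : c₄ ≤ 1)
    (hF : FirstEpisodeD (HostClass.exact (strictTinySchedule c₄ hc₄ hc₄'))) : EpisodeBaseG :=
  levelZeroData_named.episodeBaseG_of_firstEpisodeD hc₄ hc₄' hF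

end Summit.NavierStokesRegularity.FluidComputer.PalasekTowerClayBridge.Germ

end
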